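import Literature.Probability.Percolation.CollarWindowTwoFactor
import Literature.Probability.Percolation.CollarWindowOriented
import HarnessLib

/-!
# Landings in a window give a bad pattern; the two-factor bound at an oriented window

Topic `Probability/Percolation`.  Support file (definitions and proofs, no named fact) for the named
fact `SchrammSmirnov2011_thm_1_7` (Prop. 4.1, "Bays and beaches": "for every bay the endpoints of
its mouth are endpoints of interfaces which meet both β and β'; thus three crossings … land on the
arc").  (1) A **landing** of the collar exploration at the window abscissa `x` — the site `(x,0)` in
`𝒪` next to a wet face of the moat row, i.e. `(x,0) ∈ 𝒟` or `(x-1,0) ∈ 𝒟` reached across its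
examined closed bottom edge (`LandingAt`) — is where the colour of the contacts of the link domain
changes along the wall (`PortCount.transition`); two landings inside one window give pattern (Q1)
or (Q2) (`pattern_of_two_landings`).  (2) The two-factor bound `real_pattern_le_two_factor` of
`CollarWindowTwoFactor.lean` transported to a window placed by a lattice symmetry `ψ`
(`real_patternAt_le_two_factor`). [cite: SchrammSmirnov2011, §4, proof of Prop. 4.1 with Lemma 6.2]

## References

* O. Schramm, S. Smirnov, *On the scaling limits of planar percolation*, Ann. Probab. 39 (2011)
  1768–1814, arXiv:1101.5820, §4, proof of Prop. 4.1. [SchrammSmirnov2011]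
-/

noncomputable section

open MeasureTheory Metric Set

namespace Literature.Probability.Percolation

open LatticeModels Z2HalfPlane

namespace Seeded

namespace CollarDatum

variable (𝒞 : CollarDatum)

/-- **A landing at abscissa `x` of the window** (unoriented coordinates): `(x,0) ∈ 𝒪` and one of
the two row-`0` faces cornered at `(x,0)` is in `𝒟` with its bottom edge examined and closed (so
that the moat face below it is wet). [cite: SchrammSmirnov2011, §4, proof of Prop. 4.1 (endpoints of the mouths of the bays)] -/
def LandingAt (ω : BondConfig (Site 2)) (x : ℤ) : Prop :=
  OReach 𝒞.seeds (examined 𝒞.seeds ω) ω ![x, 0] ∧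
    ((DReach 𝒞.seeds (examined 𝒞.seeds ω) ω ![x, 0] ∧ bottomEdge x ∈ examined 𝒞.seeds ω ∧ bottomEdge x ∉ ω) ∨
      (DReach 𝒞.seeds (examined 𝒞.seeds ω) ω ![x - 1, 0] ∧ bottomEdge (x - 1) ∈ examined 𝒞.seeds ω ∧ bottomEdge (x - 1) ∉ ω))

variable {𝒞}

/-- **Two landings inside a window give a bad pattern**: landings at `j + 1 ≤ x < x' < j + m`
put the configuration in (Q1) (when the wet face of one landing lies between them) or in (Q2)
(when the wet faces lie outside, flanking `x`). [cite: SchrammSmirnov2011, §4, proof of Prop. 4.1 ("three crossings … land on the arc")] -/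
theorem pattern_of_two_landings {ω : BondConfig (Site 2)} {j : ℤ} {m : ℕ} {x x' : ℤ} (hjx : j + 1 ≤ x) (hxx' : x < x')
    (hx'm : x' < j + m) (hx : 𝒞.LandingAt ω x) (hx' : 𝒞.LandingAt ω x') :
    ω ∈ 𝒞.patternOne j m ∪ 𝒞.patternTwo j m := by
  obtain ⟨hOx, hfx⟩ := hx
  obtain ⟨hOx', hfx'⟩ := hx'
  rcases hfx with ⟨hD, hX, hcl⟩ | ⟨hD, hX, hcl⟩
  · -- the wet face `(x,0)` lies between the two hub sites: (Q1) with `b = x`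
    left
    exact mem_patternOne_iff.2 ⟨x, x, x', ⟨by omega, le_rfl, hxx', hx'm⟩, hOx, hOx', hD, fun h => hcl h.2⟩
  · rcases hfx' with ⟨hD', hX', hcl'⟩ | ⟨hD', hX', hcl'⟩
    · -- wet faces `(x-1,0)` and `(x',0)` flank `x`: (Q2)
      right
      exact mem_patternTwo_iff.2 ⟨x - 1, x, x', ⟨by omega, by omega, hxx'.le, hx'm⟩, hOx, hD, hD',
        fun h => hcl h.2, fun h => hcl' h.2⟩
    · -- the wet face `(x'-1,0)` lies between: (Q1) with `b = x' - 1`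
      left
      exact mem_patternOne_iff.2 ⟨x, x' - 1, x', ⟨by omega, by omega, by omega, hx'm⟩, hOx, hOx', hD', fun h => hcl' h.2⟩

/-- **The two-factor bound at an oriented window**: for `α, c₀` as in
`real_pattern_le_two_factor`, every collar datum `𝒞`, lattice symmetry `ψ` and `ψ`-window
`[j, j+m)` clean to radius `R₁ ≥ d + m + 1`, every `r ≥ 2(m + 2d + 3)` with `c₀ ≤ r + 2` and
`R ≥ 2(r + 2)` such that the far sites are at distance `≥ R` from the window corner in window
coordinates, `P(Q1 ∪ Q2 at the window) ≤ 16 · P(threeArm j m d) · ((r+2)/R)^α`.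
[cite: SchrammSmirnov2011, §4, proof of Prop. 4.1 with Lemma 6.2] -/
theorem real_patternAt_le_two_factor : ∃ α c₀ : ℝ, 0 < α ∧ 0 < c₀ ∧
    ∀ (𝒞 : CollarDatum) (ψ : LatticeSym) (j : ℤ) (m R₁ d : ℕ) (r R : ℝ), (𝒞.map ψ).CleanWindow j m R₁ →
      d + m + 1 ≤ R₁ → 2 * ((m : ℝ) + 2 * d + 3) ≤ r → c₀ ≤ r + 2 → 2 * (r + 2) ≤ R →
      (∀ u ∈ 𝒞.Far, R ≤ dist (meshPoint 1 (ψ.σ u)) (meshPoint 1 ![j, 0])) →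
      (bondPercolation (zdGraph 2) half).real (𝒞.patternOneAt ψ j m ∪ 𝒞.patternTwoAt ψ j m) ≤
        16 * (bondPercolation (zdGraph 2) half).real (threeArm j m d) * ((r + 2) / R) ^ α := by
  obtain ⟨α, c₀, hα, hc₀, h⟩ := real_pattern_le_two_factor
  refine ⟨α, c₀, hα, hc₀, fun 𝒞 ψ j m R₁ d r R hW hd hr hc₀r hrR hFar => ?_⟩
  rw [patternOneAt, patternTwoAt, ← Set.preimage_union, ψ.real_preimage_relabel]
  refine h (𝒞.map ψ) j m R₁ d r R hW hd hr hc₀r hrR fun u hu => ?_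
  have := hFar (ψ.σ.symm u) ((mem_map_Far_iff (𝒞 := 𝒞) (ψ := ψ)).1 (by simpa using hu))
  simpa using this

end CollarDatum

end Seeded

end Literature.Probability.Percolation

end
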